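import Summits.ABC.IUTFork.Conditional.AbcOfSGenuineMApex
import HarnessLib

/-!
# Branch C v7 at the M-LEVEL genuine real setting with the q-PIN DISCHARGED BY CONSTRUCTION: `abc_of_SH_v7M_qPin`

PROOF-ONLY sequel (0 definitions, 0 `Prop` facts) of abc-iut-C-cert-3's v7 certificate `Conditional/AbcOfSGenuineM.lean` (p438616, per datum
`GenuineM.cor312Of_of_SH`) + `Conditional/AbcOfSGenuineMApex.lean` (p439027, apex `abc_of_SH_v7M`: HULL-LEVEL line at abc-iut-w5-d166's
M-level sharp setting `Real.settingMSharp T.D …`, pilot regions read off the datum's own ideles; explicit per datum S_H 1 · PIN 1 · BRIDGE 1 ·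
PROV 1 · READ 1 · SIDE 0, plus CONE 1). Writer abc-iut-s2-p10 (R2 S-chain team, minted target «hPin/hQPin by-construction instance at the
genuine setting»), answering abc-iut-s2-ref 2026-08-26T11:00:08Z «hQPin (ρ, qK free) — `ρ := qRegion`, `fun _ _ => rfl` OWED at `settingMSharp`».

WHAT IS PROVED (statements about OUR typed objects):
1. `qPinned_constReading` — for ANY lattice situation `S`, setting `P` and bad-place datum `qK`, PR-1's q-pin `Cor312Vol.QPinned S P ρ qK`
   («the q-pilot region IS the `ρ`-region of `qK`», [IUTchIII] Cor. 3.12 statement p. 174 l. 5–9; abc-iut-w5-d230 `Cor312PinnedRegions`)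
   HOLDS at the setting's OWN (constant) region reading `ρ := fun _ => P.qRegion`, by `rfl` (the lineage's `qPinned_settingPrVolSharp`,
   p432576, is the instance at abc-iut-c312-7's `settingPrVolSharp`; C-cert-1's v6K and C-cert-2's v7K inline the same `rfl` at the K-level).
2. `qPinned_settingMSharp` — the instance at the M-level sharp setting, generic in the Θ- and q-idele binders `t tq htq0 Sq htq1`.
3. `GenuineM.cor312Of_of_hull_ideles` / `GenuineM.cor312Of_of_hull` — C-cert-3's per-datum `GenuineM.cor312Of_of_SH_ideles` /
   `GenuineM.cor312Of_of_SH` BY NAME with [PIN] DISCHARGED: constant reading, `qK` a free datum, the hull-level clause [S_H] read there —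
   where it says «at every label `j` and every `v_ℚ` the q-pilot region of the M-setting lies in the Θ-hull `ⁿ˒°𝒰_{j,v_ℚ}`» (abc-iut-C-cert-1
   `Antecedent.exists_qPinned_and_hull_iff`, p431727, any setting). Per datum after this file: S_H 1 · PIN 0 · BRIDGE 1 · PROV 1 · READ 1 · SIDE 0.
4. `abc_of_SH_v7M_qPin` — the apex `abc_of_SH_v7M` with its binder `hQPin` REMOVED and `ρ` fixed to the constant reading; every other binder
   ([BRIDGE] `hBridge`, [S_H] `hSH` at that reading, [PROV] `hprov`, [CONE] `hreg`, [READ] `hΘ`) VERBATIM, so G1-Θ units P5b/P6 (abc-iut-s2-p9,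
   abc-iut-w5-d166) land on the SAME binders BY NAME. Explicit 5 = S_H 1 · BRIDGE 1 · PROV 1 · READ 1 + CONE 1 (PIN 0 · SIDE 0 · FACT 0);
   v7's apex FOLLOWS from this one (under `hQPin`, `hSH` at any `ρ` rewrites to `hSH` at the constant reading: `exists_qPinned_and_hull_iff`).
NOT claimed: the TWO pins together (`PinnedRegions`; the Θ-pin is refuted as typed at `settingPrVolSharp` for every `ρ`, abc-iut-w4-d087 p431122).

HONEST FRAMING: this campaign LOCATES / CONDITIONALLY VERIFIES. Nothing here asserts that abc is proved or refuted, or that [IUTchIII]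
Cor. 3.12 / Thm. 3.11 holds or fails, or takes a side on any author (Mochizuki / Scholze–Stix / Joshi / Dupuy–Hilado); «`ABC` follows from
S_H at the constant reading + the listed hypotheses AS TYPED, at these data», nothing more; S_H is an assumption label; typed ≠ proved;
instantiated ≠ endorsed. [claim: Mochizuki2012, status: disputed] [cite: Mochizuki2012, IUTchIII Cor. 3.12 p. 173 l. 46 – p. 174 l. 9,
Step (xi-d) p. 183; IUTchI Def. 3.1 (e) p. 62; IUTchIV Thm. 1.10 p. 23] [cite: DupuyHilado2025, §3.4, §3.9]
-/

noncomputable section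

open Set Function NumberField IsDedekindDomain

namespace Summit.ABC.IUTFork.Conditional

open Thm311 Thm311.Real Cor312 Cor312Vol Cor312Prov Literature.IUT.LogThetaLattice Literature.IUT.LogVolume
  Literature.IUT.HodgeTheaters Literature.IUT.LogVolume.ThetaData Literature.NumberTheory.NumberFields

/-! ## §1. The q-pin by construction: any setting, and the M-level sharp setting -/

/-- **The q-pin HOLDS at the setting's own constant region reading, for EVERY lattice situation, setting and datum `qK`.** PR-1's
`Cor312Vol.QPinned S P ρ qK` unfolds to `∀ j v_ℚ, P.qRegion j v_ℚ = ρ qK j v_ℚ` ([IUTchIII] Cor. 3.12 statement p. 174 l. 5–9: the q-pilot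
region is formed from `qK` «with NO indeterminacy»); at `ρ := fun _ => P.qRegion` both sides are the same term. This is the by-construction
(non-vacuity) witness for the [PIN] binder of every branch-C certificate, at any level (F / K / M). [claim: Mochizuki2012, status: disputed] -/
theorem qPinned_constReading {T : ThetaIndex} (S : LatticeSituation T) (P : Cor312.Setting S.toSituation)
    (qK : ∀ v : T.V, v ∈ T.Vbad → Set (S.L.StarPacket v)) :
    Cor312Vol.QPinned S P (fun _ => P.qRegion) qK :=
  fun _ _ => rfl

section PerDatum
variable {F K Fbar : Type} [Field F] [NumberField F] [Field K] [NumberField K] [Algebra F K] [Field Fbar]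
  [Algebra F Fbar] [Algebra K Fbar] {E : WeierstrassCurve F} [E.IsElliptic] {l : ℕ} {Pb : BadPlacePredicates K}
variable (D : InitialThetaData F K Fbar E l Pb) {I : ThetaVolumeInput (fieldOfModuli E) K}
  (M : Type) [Field M] [NumberField M]
  (archPk : ∀ (j : (thetaIndexOfInitial D).Label) (vQ : (thetaIndexOfInitial D).VQ),
    Set ((logShellsOfInitialDH D (analyticLogvVal K)).Packet j vQ))
  (archSub : ∀ (j : (thetaIndexOfInitial D).Label) (v : (thetaIndexOfInitial D).V),
    Set ((logShellsOfInitialDH D (analyticLogvVal K)).Packet j ((thetaIndexOfInitial D).over v)))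
  (Ψ : ℤ → ∀ v : (thetaIndexOfInitial D).V, v ∈ (thetaIndexOfInitial D).Vbad →
    Set ((logShellsOfInitialDH D (analyticLogvVal K)).StarPacket v))
  (act : ℤ → ∀ v : (thetaIndexOfInitial D).V, v ∈ (thetaIndexOfInitial D).Vbad →
    (logShellsOfInitialDH D (analyticLogvVal K)).StarPacket v →
      Module.End ℚ ((logShellsOfInitialDH D (analyticLogvVal K)).StarPacket v))
  (Mmod : ℤ → ∀ j : (thetaIndexOfInitial D).LabelStar, Set ((logShellsOfInitialDH D (analyticLogvVal K)).GlobalPacket j.1))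
  (region : ℤ → ∀ j : (thetaIndexOfInitial D).LabelStar, FinDivisor M → ∀ vQ : (thetaIndexOfInitial D).VQ,
    Set ((logShellsOfInitialDH D (analyticLogvVal K)).Packet j.1 vQ))
  (frobAdm : ℤ → ℤ → ∀ (j : (thetaIndexOfInitial D).Label) (vQ : (thetaIndexOfInitial D).VQ),
    Set ((logShellsOfInitialDH D (analyticLogvVal K)).Packet j vQ) → Prop)
  (frobLogvol : ℤ → ℤ → ∀ (j : (thetaIndexOfInitial D).Label) (vQ : (thetaIndexOfInitial D).VQ),
    Set ((logShellsOfInitialDH D (analyticLogvVal K)).Packet j vQ) → ℝ)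
  (frobΨ : ℤ → ℤ → ∀ v : (thetaIndexOfInitial D).V, v ∈ (thetaIndexOfInitial D).Vbad →
    Set ((logShellsOfInitialDH D (analyticLogvVal K)).StarPacket v))
  (frobMmod : ℤ → ℤ → ∀ j : (thetaIndexOfInitial D).LabelStar, Set ((logShellsOfInitialDH D (analyticLogvVal K)).GlobalPacket j.1))
  (unitImage : ℤ → ℤ → ℕ → ∀ (j : (thetaIndexOfInitial D).Label) (vQ : (thetaIndexOfInitial D).VQ),
    Set ((logShellsOfInitialDH D (analyticLogvVal K)).Packet j vQ))
  (ballImage : ℤ → ℤ → ∀ (j : (thetaIndexOfInitial D).Label) (vQ : (thetaIndexOfInitial D).VQ),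
    Set ((logShellsOfInitialDH D (analyticLogvVal K)).Packet j vQ))
  (thetaDiv : ℤ → ℤ → LgpDivisor M (thetaIndexOfInitial D).lstar)
  (n : ℤ) {HT : Type} {LogLink : HT → HT → Type} {IsFull : ∀ {s t : HT}, LogLink s t → Prop}
  (lat : LGPGaussianLogThetaLattice LogLink IsFull)
  {Frd : Type} {IsoF : Frd → Frd → Type} {Ob : Frd → Type} {realify : Frd → Frd} {Strip : Type}
  {IsoS : Strip → Strip → Type} {Mv : ∀ v : (thetaIndexOfInitial D).V, v ∈ (thetaIndexOfInitial D).Vbad → Type}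
  [∀ v h, Monoid (Mv v h)]
  (sig : GlobalLGPFrobenioidSignature (thetaIndexOfInitial D).lstar (thetaIndexOfInitial D).V
    (· ∈ (thetaIndexOfInitial D).Vbad) Frd IsoF Ob realify Strip IsoS Mv)
  (split : SplittingMonoids Mv) {ObΔ : Type} {N : ∀ v : (thetaIndexOfInitial D).V, v ∈ (thetaIndexOfInitial D).Vbad → Type}
  [∀ v h, Monoid (N v h)] (qData : QPilotData ObΔ N)
  (qK : ∀ v : (thetaIndexOfInitial D).V, v ∈ (thetaIndexOfInitial D).Vbad →
    Set ((logShellsOfInitialDH D (analyticLogvVal K)).StarPacket v))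

/-- **`hQPin` BY CONSTRUCTION at the M-level sharp setting** (abc-iut-w5-d166 `Real.settingMSharp`, p435453; any column binders, generic
Θ- and q-idele binders `t tq htq0 Sq htq1`): v7's [PIN] binder type BY NAME at the witness `ρ := fun _ => P.qRegion` (the M-setting's q-side
glue is constant in the object: the Dupuy–Hilado idele box of `t_q` in `K_{v̲}`) and EVERY `qK`. [claim: Mochizuki2012, status: disputed] -/
theorem qPinned_settingMSharp
    (t : ∀ (u : FinitePlace ℚ) (_ : Fin (thetaIndexOfInitial D).lstar) (x : (thetaIndexOfInitial D).Fibre (Val.non u)),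
      kOfM D (ratChar u) u (natCast_ratChar_mem u) x)
    (tq : ∀ (u : FinitePlace ℚ) (x : (thetaIndexOfInitial D).Fibre (Val.non u)), kOfM D (ratChar u) u (natCast_ratChar_mem u) x)
    (htq0 : ∀ u x, tq u x ≠ 0) (Sq : Finset (FinitePlace ℚ))
    (htq1 : ∀ (u : FinitePlace ℚ) (x : (thetaIndexOfInitial D).Fibre (Val.non u)), u ∉ Sq → ‖tq u x‖ = 1) :
    Cor312Vol.QPinned
      (LatticeSituation.ofShells (logShellsOfInitialDH D (analyticLogvVal K)) M archPk archSub
        (frameVolumePiecesOfInitialDH D (logvAnalyticVal_analyticLogvVal (K := K))).Adm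
        (frameVolumePiecesOfInitialDH D (logvAnalyticVal_analyticLogvVal (K := K))).logvol Ψ act Mmod region frobAdm frobLogvol
        frobΨ frobMmod unitImage ballImage thetaDiv)
      (settingMSharp D (logvAnalyticVal_analyticLogvVal (K := K)) M archPk archSub Ψ act Mmod region n lat sig split qData t tq
        htq0 Sq htq1)
      (fun _ => (settingMSharp D (logvAnalyticVal_analyticLogvVal (K := K)) M archPk archSub Ψ act Mmod region n lat sig split qData t tq
        htq0 Sq htq1).qRegion) qK :=
  qPinned_constReading (LatticeSituation.ofShells (logShellsOfInitialDH D (analyticLogvVal K)) M archPk archSub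
    (frameVolumePiecesOfInitialDH D (logvAnalyticVal_analyticLogvVal (K := K))).Adm
    (frameVolumePiecesOfInitialDH D (logvAnalyticVal_analyticLogvVal (K := K))).logvol Ψ act Mmod region frobAdm frobLogvol
    frobΨ frobMmod unitImage ballImage thetaDiv) _ qK

/-! ## §2. One datum with [PIN] discharged: generic ideles, then the ideles READ OFF the volume input `I` -/
/-- **C-cert-3's `GenuineM.cor312Of_of_SH_ideles` with [PIN] DISCHARGED BY CONSTRUCTION** (`qPinned_settingMSharp`; `ρ := fun _ => P.qRegion`,
`qK` free; generic ideles in `K_{v̲}`): `I.Cor312Of` from [BRIDGE], [S_H] READ at the constant reading (= «q-pilot region ⊆ Θ-hull at every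
label and `v_ℚ`»), [PROV] `IsSettingOf T.D P`, [READ] one-sided — explicit S_H 1 · PIN 0 · BRIDGE 1 · PROV 1 · READ 1. «`I.Cor312Of` follows
from these hypotheses as typed» — no side taken on [IUTchIII] Cor. 3.12. [claim: Mochizuki2012, status: disputed] -/
theorem GenuineM.cor312Of_of_hull_ideles (hI : ThetaData.IsVolumeInputOf D I)
    (t : ∀ (u : FinitePlace ℚ) (_ : Fin (thetaIndexOfInitial D).lstar) (x : (thetaIndexOfInitial D).Fibre (Val.non u)),
      kOfM D (ratChar u) u (natCast_ratChar_mem u) x)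
    (tq : ∀ (u : FinitePlace ℚ) (x : (thetaIndexOfInitial D).Fibre (Val.non u)), kOfM D (ratChar u) u (natCast_ratChar_mem u) x)
    (htq0 : ∀ u x, tq u x ≠ 0) (Sq : Finset (FinitePlace ℚ))
    (htq1 : ∀ (u : FinitePlace ℚ) (x : (thetaIndexOfInitial D).Fibre (Val.non u)), u ∉ Sq → ‖tq u x‖ = 1)
    (hBridge : Cor312Vol.BridgeHyps
      (settingMSharp D (logvAnalyticVal_analyticLogvVal (K := K)) M archPk archSub Ψ act Mmod region n lat sig split qData t tq
        htq0 Sq htq1))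
    (hSH : Cor312Vol.PilotKummerCompatHull
      (LatticeSituation.ofShells (logShellsOfInitialDH D (analyticLogvVal K)) M archPk archSub
        (frameVolumePiecesOfInitialDH D (logvAnalyticVal_analyticLogvVal (K := K))).Adm
        (frameVolumePiecesOfInitialDH D (logvAnalyticVal_analyticLogvVal (K := K))).logvol Ψ act Mmod region frobAdm frobLogvol
        frobΨ frobMmod unitImage ballImage thetaDiv)
      (settingMSharp D (logvAnalyticVal_analyticLogvVal (K := K)) M archPk archSub Ψ act Mmod region n lat sig split qData t tq
        htq0 Sq htq1)
      (fun _ => (settingMSharp D (logvAnalyticVal_analyticLogvVal (K := K)) M archPk archSub Ψ act Mmod region n lat sig split qData t tq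
        htq0 Sq htq1).qRegion) qK)
    (hprov : Cor312Prov.IsSettingOf D
      (settingMSharp D (logvAnalyticVal_analyticLogvVal (K := K)) M archPk archSub Ψ act Mmod region n lat sig split qData t tq
        htq0 Sq htq1))
    (hΘ : (settingMSharp D (logvAnalyticVal_analyticLogvVal (K := K)) M archPk archSub Ψ act Mmod region n lat sig split qData t tq
        htq0 Sq htq1).negLogTheta ≤ ((I.negLogTheta : ℝ) : WithTop ℝ)) :
    I.Cor312Of :=
  GenuineM.cor312Of_of_SH_ideles D M archPk archSub Ψ act Mmod region frobAdm frobLogvol frobΨ frobMmod unitImage ballImage thetaDiv n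
    lat sig split qData _ qK hI t tq htq0 Sq htq1 hBridge hSH
    (qPinned_settingMSharp D M archPk archSub Ψ act Mmod region frobAdm frobLogvol frobΨ frobMmod unitImage ballImage thetaDiv n lat
      sig split qData qK t tq htq0 Sq htq1)
    hprov hΘ

/-- **C-cert-3's per-datum `GenuineM.cor312Of_of_SH` (pilot regions READ OFF the genuine ideles `tThetaM`/`tqM` of `ideleDataOf T.D hI`; SIDE 0)
with [PIN] DISCHARGED BY CONSTRUCTION** (`ρ := fun _ => P.qRegion`, `qK` free): `I.Cor312Of` from [BRIDGE] + [S_H] (at the constant reading) +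
[PROV] + [READ] — explicit S_H 1 · PIN 0 · BRIDGE 1 · PROV 1 · READ 1 · SIDE 0. «`I.Cor312Of` follows from these hypotheses as typed, at these
data» — no side taken on [IUTchIII] Cor. 3.12; typed ≠ proved. [claim: Mochizuki2012, status: disputed] -/
theorem GenuineM.cor312Of_of_hull (hI : ThetaData.IsVolumeInputOf D I)
    (hBridge : Cor312Vol.BridgeHyps
      (settingMSharp D (logvAnalyticVal_analyticLogvVal (K := K)) M archPk archSub Ψ act Mmod region n lat sig split qData
        (fun u i x => tThetaM D (ratChar u) u (natCast_ratChar_mem u) (ideleDataOf D hI) i x)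
        (fun u x => tqM D (ratChar u) u (natCast_ratChar_mem u) (ideleDataOf D hI) x)
        (fun u x => tqM_ne_zero D (ratChar u) u (natCast_ratChar_mem u) (ideleDataOf D hI) x)
        (GenuineM.finite_ratPlaces_under_S D).toFinset
        (fun u x hu => norm_tqM_eq_one_of_not_mem D (ratChar u) u (natCast_ratChar_mem u) (ideleDataOf D hI) x
          fun hx => hu ((Set.Finite.mem_toFinset _).mpr ⟨x, hx⟩))))
    (hSH : Cor312Vol.PilotKummerCompatHull
      (LatticeSituation.ofShells (logShellsOfInitialDH D (analyticLogvVal K)) M archPk archSub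
        (frameVolumePiecesOfInitialDH D (logvAnalyticVal_analyticLogvVal (K := K))).Adm
        (frameVolumePiecesOfInitialDH D (logvAnalyticVal_analyticLogvVal (K := K))).logvol Ψ act Mmod region frobAdm frobLogvol
        frobΨ frobMmod unitImage ballImage thetaDiv)
      (settingMSharp D (logvAnalyticVal_analyticLogvVal (K := K)) M archPk archSub Ψ act Mmod region n lat sig split qData
        (fun u i x => tThetaM D (ratChar u) u (natCast_ratChar_mem u) (ideleDataOf D hI) i x)
        (fun u x => tqM D (ratChar u) u (natCast_ratChar_mem u) (ideleDataOf D hI) x)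
        (fun u x => tqM_ne_zero D (ratChar u) u (natCast_ratChar_mem u) (ideleDataOf D hI) x)
        (GenuineM.finite_ratPlaces_under_S D).toFinset
        (fun u x hu => norm_tqM_eq_one_of_not_mem D (ratChar u) u (natCast_ratChar_mem u) (ideleDataOf D hI) x
          fun hx => hu ((Set.Finite.mem_toFinset _).mpr ⟨x, hx⟩)))
      (fun _ => (settingMSharp D (logvAnalyticVal_analyticLogvVal (K := K)) M archPk archSub Ψ act Mmod region n lat sig split qData
        (fun u i x => tThetaM D (ratChar u) u (natCast_ratChar_mem u) (ideleDataOf D hI) i x)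
        (fun u x => tqM D (ratChar u) u (natCast_ratChar_mem u) (ideleDataOf D hI) x)
        (fun u x => tqM_ne_zero D (ratChar u) u (natCast_ratChar_mem u) (ideleDataOf D hI) x)
        (GenuineM.finite_ratPlaces_under_S D).toFinset
        (fun u x hu => norm_tqM_eq_one_of_not_mem D (ratChar u) u (natCast_ratChar_mem u) (ideleDataOf D hI) x
          fun hx => hu ((Set.Finite.mem_toFinset _).mpr ⟨x, hx⟩))).qRegion) qK)
    (hprov : Cor312Prov.IsSettingOf D
      (settingMSharp D (logvAnalyticVal_analyticLogvVal (K := K)) M archPk archSub Ψ act Mmod region n lat sig split qData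
        (fun u i x => tThetaM D (ratChar u) u (natCast_ratChar_mem u) (ideleDataOf D hI) i x)
        (fun u x => tqM D (ratChar u) u (natCast_ratChar_mem u) (ideleDataOf D hI) x)
        (fun u x => tqM_ne_zero D (ratChar u) u (natCast_ratChar_mem u) (ideleDataOf D hI) x)
        (GenuineM.finite_ratPlaces_under_S D).toFinset
        (fun u x hu => norm_tqM_eq_one_of_not_mem D (ratChar u) u (natCast_ratChar_mem u) (ideleDataOf D hI) x
          fun hx => hu ((Set.Finite.mem_toFinset _).mpr ⟨x, hx⟩))))
    (hΘ : (settingMSharp D (logvAnalyticVal_analyticLogvVal (K := K)) M archPk archSub Ψ act Mmod region n lat sig split qData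
        (fun u i x => tThetaM D (ratChar u) u (natCast_ratChar_mem u) (ideleDataOf D hI) i x)
        (fun u x => tqM D (ratChar u) u (natCast_ratChar_mem u) (ideleDataOf D hI) x)
        (fun u x => tqM_ne_zero D (ratChar u) u (natCast_ratChar_mem u) (ideleDataOf D hI) x)
        (GenuineM.finite_ratPlaces_under_S D).toFinset
        (fun u x hu => norm_tqM_eq_one_of_not_mem D (ratChar u) u (natCast_ratChar_mem u) (ideleDataOf D hI) x
          fun hx => hu ((Set.Finite.mem_toFinset _).mpr ⟨x, hx⟩))).negLogTheta ≤
      ((I.negLogTheta : ℝ) : WithTop ℝ)) :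
    I.Cor312Of :=
  GenuineM.cor312Of_of_hull_ideles D M archPk archSub Ψ act Mmod region frobAdm frobLogvol frobΨ frobMmod unitImage ballImage thetaDiv n
    lat sig split qData qK hI _ _ _ _ _ hBridge hSH hprov hΘ

end PerDatum

/-! ## §3. The apex with the q-pin discharged -/

section Family
open Literature.NumberTheory.DiophantineGeometry.GenEll Summit.ABC.ABC.Theorems

/-- **`abc_of_SH_v7M_qPin` — abc-iut-C-cert-3's apex `abc_of_SH_v7M` (p439027) with the q-pin `hQPin` DISCHARGED BY CONSTRUCTION**: the region
reading is fixed to the M-setting's own q-side glue `ρ := fun _ => P.qRegion` (constant in the object), the Kummer datum `qK` stays a free,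
uncounted datum, and PR-1's q-pin is then the theorem `qPinned_settingMSharp` (`rfl`). All other data and hypotheses of v7 VERBATIM:
[BRIDGE] `hBridge` · [S_H] `hSH` (at the constant reading: the all-labels hull inclusion «q-pilot region ⊆ Θ-hull» of the M-setting) ·
[PROV] `hprov` · [CONE] `hreg` · [READ] `hΘ` one-sided — explicit 5 = S_H 1 · BRIDGE 1 · PROV 1 · READ 1 + CONE 1 (PIN 0 · SIDE 0 · FACT 0).
Proof (as v7's): per datum `GenuineM.cor312Of_of_hull` (§2), then c312-8's `ThetaPartII.ABC_of_cor312_of_hullRegime`. «`ABC` follows from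
S_H + these hypotheses as typed, at these data» — no side taken; typed ≠ proved; instantiated ≠ endorsed. [claim: Mochizuki2012, status: disputed] -/
theorem abc_of_SH_v7M_qPin
    -- DATA, per datum: the context binders of the M-level sharp setting (logs FIXED: analytic), the column data, the Kummer datum qK — NO ρ
    (M : ∀ (P : NFPoint) (l : ℕ) (T : Cor22.ThetaVolumeDatumAt P l), Type) [∀ P l T, Field (M P l T)] [∀ P l T, NumberField (M P l T)]
    (archPk : ∀ (P : NFPoint) (l : ℕ) (T : Cor22.ThetaVolumeDatumAt P l), letI := T.instFieldF; letI := T.instNumberFieldF; letI := T.instAlgebraF; letI := T.instFieldK;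
        letI := T.instNumberFieldK; letI := T.instAlgebraK; letI := T.instFieldFbar; letI := T.instAlgebraFbar;
        letI := T.instAlgebraKFbar; letI := T.instIsElliptic;
      ∀ (j : (thetaIndexOfInitial T.D).Label) (vQ : (thetaIndexOfInitial T.D).VQ), Set ((logShellsOfInitialDH T.D (analyticLogvVal T.K)).Packet j vQ))
    (archSub : ∀ (P : NFPoint) (l : ℕ) (T : Cor22.ThetaVolumeDatumAt P l), letI := T.instFieldF; letI := T.instNumberFieldF; letI := T.instAlgebraF; letI := T.instFieldK;
        letI := T.instNumberFieldK; letI := T.instAlgebraK; letI := T.instFieldFbar; letI := T.instAlgebraFbar;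
        letI := T.instAlgebraKFbar; letI := T.instIsElliptic;
      ∀ (j : (thetaIndexOfInitial T.D).Label) (v : (thetaIndexOfInitial T.D).V), Set ((logShellsOfInitialDH T.D (analyticLogvVal T.K)).Packet j ((thetaIndexOfInitial T.D).over v)))
    (Ψ : ∀ (P : NFPoint) (l : ℕ) (T : Cor22.ThetaVolumeDatumAt P l), letI := T.instFieldF; letI := T.instNumberFieldF; letI := T.instAlgebraF; letI := T.instFieldK;
        letI := T.instNumberFieldK; letI := T.instAlgebraK; letI := T.instFieldFbar; letI := T.instAlgebraFbar;
        letI := T.instAlgebraKFbar; letI := T.instIsElliptic;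
      ℤ → ∀ v : (thetaIndexOfInitial T.D).V, v ∈ (thetaIndexOfInitial T.D).Vbad → Set ((logShellsOfInitialDH T.D (analyticLogvVal T.K)).StarPacket v))
    (act : ∀ (P : NFPoint) (l : ℕ) (T : Cor22.ThetaVolumeDatumAt P l), letI := T.instFieldF; letI := T.instNumberFieldF; letI := T.instAlgebraF; letI := T.instFieldK;
        letI := T.instNumberFieldK; letI := T.instAlgebraK; letI := T.instFieldFbar; letI := T.instAlgebraFbar;
        letI := T.instAlgebraKFbar; letI := T.instIsElliptic;
      ℤ → ∀ v : (thetaIndexOfInitial T.D).V, v ∈ (thetaIndexOfInitial T.D).Vbad → (logShellsOfInitialDH T.D (analyticLogvVal T.K)).StarPacket v → Module.End ℚ ((logShellsOfInitialDH T.D (analyticLogvVal T.K)).StarPacket v))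
    (Mmod : ∀ (P : NFPoint) (l : ℕ) (T : Cor22.ThetaVolumeDatumAt P l), letI := T.instFieldF; letI := T.instNumberFieldF; letI := T.instAlgebraF; letI := T.instFieldK;
        letI := T.instNumberFieldK; letI := T.instAlgebraK; letI := T.instFieldFbar; letI := T.instAlgebraFbar;
        letI := T.instAlgebraKFbar; letI := T.instIsElliptic;
      ℤ → ∀ j : (thetaIndexOfInitial T.D).LabelStar, Set ((logShellsOfInitialDH T.D (analyticLogvVal T.K)).GlobalPacket j.1))
    (region : ∀ (P : NFPoint) (l : ℕ) (T : Cor22.ThetaVolumeDatumAt P l), letI := T.instFieldF; letI := T.instNumberFieldF; letI := T.instAlgebraF; letI := T.instFieldK;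
        letI := T.instNumberFieldK; letI := T.instAlgebraK; letI := T.instFieldFbar; letI := T.instAlgebraFbar;
        letI := T.instAlgebraKFbar; letI := T.instIsElliptic;
      ℤ → ∀ j : (thetaIndexOfInitial T.D).LabelStar, FinDivisor (M P l T) → ∀ vQ : (thetaIndexOfInitial T.D).VQ, Set ((logShellsOfInitialDH T.D (analyticLogvVal T.K)).Packet j.1 vQ))
    (frobAdm : ∀ (P : NFPoint) (l : ℕ) (T : Cor22.ThetaVolumeDatumAt P l), letI := T.instFieldF; letI := T.instNumberFieldF; letI := T.instAlgebraF; letI := T.instFieldK;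
        letI := T.instNumberFieldK; letI := T.instAlgebraK; letI := T.instFieldFbar; letI := T.instAlgebraFbar;
        letI := T.instAlgebraKFbar; letI := T.instIsElliptic;
      ℤ → ℤ → ∀ (j : (thetaIndexOfInitial T.D).Label) (vQ : (thetaIndexOfInitial T.D).VQ), Set ((logShellsOfInitialDH T.D (analyticLogvVal T.K)).Packet j vQ) → Prop)
    (frobLogvol : ∀ (P : NFPoint) (l : ℕ) (T : Cor22.ThetaVolumeDatumAt P l), letI := T.instFieldF; letI := T.instNumberFieldF; letI := T.instAlgebraF; letI := T.instFieldK;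
        letI := T.instNumberFieldK; letI := T.instAlgebraK; letI := T.instFieldFbar; letI := T.instAlgebraFbar;
        letI := T.instAlgebraKFbar; letI := T.instIsElliptic;
      ℤ → ℤ → ∀ (j : (thetaIndexOfInitial T.D).Label) (vQ : (thetaIndexOfInitial T.D).VQ), Set ((logShellsOfInitialDH T.D (analyticLogvVal T.K)).Packet j vQ) → ℝ)
    (frobΨ : ∀ (P : NFPoint) (l : ℕ) (T : Cor22.ThetaVolumeDatumAt P l), letI := T.instFieldF; letI := T.instNumberFieldF; letI := T.instAlgebraF; letI := T.instFieldK;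
        letI := T.instNumberFieldK; letI := T.instAlgebraK; letI := T.instFieldFbar; letI := T.instAlgebraFbar;
        letI := T.instAlgebraKFbar; letI := T.instIsElliptic;
      ℤ → ℤ → ∀ v : (thetaIndexOfInitial T.D).V, v ∈ (thetaIndexOfInitial T.D).Vbad → Set ((logShellsOfInitialDH T.D (analyticLogvVal T.K)).StarPacket v))
    (frobMmod : ∀ (P : NFPoint) (l : ℕ) (T : Cor22.ThetaVolumeDatumAt P l), letI := T.instFieldF; letI := T.instNumberFieldF; letI := T.instAlgebraF; letI := T.instFieldK;
        letI := T.instNumberFieldK; letI := T.instAlgebraK; letI := T.instFieldFbar; letI := T.instAlgebraFbar;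
        letI := T.instAlgebraKFbar; letI := T.instIsElliptic;
      ℤ → ℤ → ∀ j : (thetaIndexOfInitial T.D).LabelStar, Set ((logShellsOfInitialDH T.D (analyticLogvVal T.K)).GlobalPacket j.1))
    (unitImage : ∀ (P : NFPoint) (l : ℕ) (T : Cor22.ThetaVolumeDatumAt P l), letI := T.instFieldF; letI := T.instNumberFieldF; letI := T.instAlgebraF; letI := T.instFieldK;
        letI := T.instNumberFieldK; letI := T.instAlgebraK; letI := T.instFieldFbar; letI := T.instAlgebraFbar;
        letI := T.instAlgebraKFbar; letI := T.instIsElliptic;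
      ℤ → ℤ → ℕ → ∀ (j : (thetaIndexOfInitial T.D).Label) (vQ : (thetaIndexOfInitial T.D).VQ), Set ((logShellsOfInitialDH T.D (analyticLogvVal T.K)).Packet j vQ))
    (ballImage : ∀ (P : NFPoint) (l : ℕ) (T : Cor22.ThetaVolumeDatumAt P l), letI := T.instFieldF; letI := T.instNumberFieldF; letI := T.instAlgebraF; letI := T.instFieldK;
        letI := T.instNumberFieldK; letI := T.instAlgebraK; letI := T.instFieldFbar; letI := T.instAlgebraFbar;
        letI := T.instAlgebraKFbar; letI := T.instIsElliptic;
      ℤ → ℤ → ∀ (j : (thetaIndexOfInitial T.D).Label) (vQ : (thetaIndexOfInitial T.D).VQ), Set ((logShellsOfInitialDH T.D (analyticLogvVal T.K)).Packet j vQ))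
    (thetaDiv : ∀ (P : NFPoint) (l : ℕ) (T : Cor22.ThetaVolumeDatumAt P l), letI := T.instFieldF; letI := T.instNumberFieldF; letI := T.instAlgebraF; letI := T.instFieldK;
        letI := T.instNumberFieldK; letI := T.instAlgebraK; letI := T.instFieldFbar; letI := T.instAlgebraFbar;
        letI := T.instAlgebraKFbar; letI := T.instIsElliptic;
      ℤ → ℤ → LgpDivisor (M P l T) (thetaIndexOfInitial T.D).lstar)
    (n : ∀ (P : NFPoint) (l : ℕ) (T : Cor22.ThetaVolumeDatumAt P l), ℤ)
    {HT : ∀ (P : NFPoint) (l : ℕ) (T : Cor22.ThetaVolumeDatumAt P l), Type} {LogLink : ∀ (P : NFPoint) (l : ℕ) (T : Cor22.ThetaVolumeDatumAt P l), HT P l T → HT P l T → Type}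
    {IsFull : ∀ (P : NFPoint) (l : ℕ) (T : Cor22.ThetaVolumeDatumAt P l), ∀ {s t : HT P l T}, LogLink P l T s t → Prop}
    (lat : ∀ (P : NFPoint) (l : ℕ) (T : Cor22.ThetaVolumeDatumAt P l), LGPGaussianLogThetaLattice (LogLink P l T) (IsFull P l T))
    {Frd : ∀ (P : NFPoint) (l : ℕ) (T : Cor22.ThetaVolumeDatumAt P l), Type} {IsoF : ∀ (P : NFPoint) (l : ℕ) (T : Cor22.ThetaVolumeDatumAt P l), Frd P l T → Frd P l T → Type} {Ob : ∀ (P : NFPoint) (l : ℕ) (T : Cor22.ThetaVolumeDatumAt P l), Frd P l T → Type}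
    {realify : ∀ (P : NFPoint) (l : ℕ) (T : Cor22.ThetaVolumeDatumAt P l), Frd P l T → Frd P l T} {Strip : ∀ (P : NFPoint) (l : ℕ) (T : Cor22.ThetaVolumeDatumAt P l), Type} {IsoS : ∀ (P : NFPoint) (l : ℕ) (T : Cor22.ThetaVolumeDatumAt P l), Strip P l T → Strip P l T → Type}
    {Mv : ∀ (P : NFPoint) (l : ℕ) (T : Cor22.ThetaVolumeDatumAt P l), letI := T.instFieldF; letI := T.instNumberFieldF; letI := T.instAlgebraF; letI := T.instFieldK;
        letI := T.instNumberFieldK; letI := T.instAlgebraK; letI := T.instFieldFbar; letI := T.instAlgebraFbar;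
        letI := T.instAlgebraKFbar; letI := T.instIsElliptic;
      ∀ v : (thetaIndexOfInitial T.D).V, v ∈ (thetaIndexOfInitial T.D).Vbad → Type}
    [∀ P l T v h, Monoid (Mv P l T v h)]
    (sig : ∀ (P : NFPoint) (l : ℕ) (T : Cor22.ThetaVolumeDatumAt P l), letI := T.instFieldF; letI := T.instNumberFieldF; letI := T.instAlgebraF; letI := T.instFieldK;
        letI := T.instNumberFieldK; letI := T.instAlgebraK; letI := T.instFieldFbar; letI := T.instAlgebraFbar;
        letI := T.instAlgebraKFbar; letI := T.instIsElliptic;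
      GlobalLGPFrobenioidSignature (thetaIndexOfInitial T.D).lstar (thetaIndexOfInitial T.D).V (· ∈ (thetaIndexOfInitial T.D).Vbad) (Frd P l T) (IsoF P l T) (Ob P l T) (realify P l T)
        (Strip P l T) (IsoS P l T) (Mv P l T))
    (split : ∀ (P : NFPoint) (l : ℕ) (T : Cor22.ThetaVolumeDatumAt P l), SplittingMonoids (Mv P l T))
    {ObΔ : ∀ (P : NFPoint) (l : ℕ) (T : Cor22.ThetaVolumeDatumAt P l), Type}
    {N : ∀ (P : NFPoint) (l : ℕ) (T : Cor22.ThetaVolumeDatumAt P l), letI := T.instFieldF; letI := T.instNumberFieldF; letI := T.instAlgebraF; letI := T.instFieldK;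
        letI := T.instNumberFieldK; letI := T.instAlgebraK; letI := T.instFieldFbar; letI := T.instAlgebraFbar;
        letI := T.instAlgebraKFbar; letI := T.instIsElliptic;
      ∀ v : (thetaIndexOfInitial T.D).V, v ∈ (thetaIndexOfInitial T.D).Vbad → Type}
    [∀ P l T v h, Monoid (N P l T v h)] (qData : ∀ (P : NFPoint) (l : ℕ) (T : Cor22.ThetaVolumeDatumAt P l), QPilotData (ObΔ P l T) (N P l T))
    (qK : ∀ (P : NFPoint) (l : ℕ) (T : Cor22.ThetaVolumeDatumAt P l), letI := T.instFieldF; letI := T.instNumberFieldF; letI := T.instAlgebraF; letI := T.instFieldK;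
        letI := T.instNumberFieldK; letI := T.instAlgebraK; letI := T.instFieldFbar; letI := T.instAlgebraFbar;
        letI := T.instAlgebraKFbar; letI := T.instIsElliptic;
      ∀ v : (thetaIndexOfInitial T.D).V, v ∈ (thetaIndexOfInitial T.D).Vbad → Set ((logShellsOfInitialDH T.D (analyticLogvVal T.K)).StarPacket v))
    -- [BRIDGE] abc-iut-c312-6's `BridgeHyps` of the M-setting (G1-Θ unit P5's deliverable AS TYPED)
    (hBridge : ∀ (P : NFPoint) (l : ℕ) (T : Cor22.ThetaVolumeDatumAt P l), letI := T.instFieldF; letI := T.instNumberFieldF; letI := T.instAlgebraF; letI := T.instFieldK;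
        letI := T.instNumberFieldK; letI := T.instAlgebraK; letI := T.instFieldFbar; letI := T.instAlgebraFbar;
        letI := T.instAlgebraKFbar; letI := T.instIsElliptic;
      Cor312Vol.BridgeHyps
        (settingMSharp T.D (logvAnalyticVal_analyticLogvVal (K := T.K)) (M P l T) (archPk P l T) (archSub P l T) (Ψ P l T) (act P l T)
          (Mmod P l T) (region P l T) (n P l T) (lat P l T) (sig P l T) (split P l T) (qData P l T)
          (fun u i x => tThetaM T.D (ratChar u) u (natCast_ratChar_mem u) (ideleDataOf T.D T.isVolumeInputOf) i x)
          (fun u x => tqM T.D (ratChar u) u (natCast_ratChar_mem u) (ideleDataOf T.D T.isVolumeInputOf) x)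
          (fun u x => tqM_ne_zero T.D (ratChar u) u (natCast_ratChar_mem u) (ideleDataOf T.D T.isVolumeInputOf) x)
          (GenuineM.finite_ratPlaces_under_S T.D).toFinset
          (fun u x hu => norm_tqM_eq_one_of_not_mem T.D (ratChar u) u (natCast_ratChar_mem u) (ideleDataOf T.D T.isVolumeInputOf) x
            fun hx => hu ((Set.Finite.mem_toFinset _).mpr ⟨x, hx⟩))))
    -- [S_H] the HULL-LEVEL form of the printed clause AT THE CONSTANT (PINNED) READING ρ := fun _ => qRegion, at every datum, AT THESE DATA
    (hSH : ∀ (P : NFPoint) (l : ℕ) (T : Cor22.ThetaVolumeDatumAt P l), letI := T.instFieldF; letI := T.instNumberFieldF; letI := T.instAlgebraF; letI := T.instFieldK;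
        letI := T.instNumberFieldK; letI := T.instAlgebraK; letI := T.instFieldFbar; letI := T.instAlgebraFbar;
        letI := T.instAlgebraKFbar; letI := T.instIsElliptic;
      Cor312Vol.PilotKummerCompatHull
        (LatticeSituation.ofShells (logShellsOfInitialDH T.D (analyticLogvVal T.K)) (M P l T) (archPk P l T) (archSub P l T)
          (frameVolumePiecesOfInitialDH T.D (logvAnalyticVal_analyticLogvVal (K := T.K))).Adm
          (frameVolumePiecesOfInitialDH T.D (logvAnalyticVal_analyticLogvVal (K := T.K))).logvol (Ψ P l T) (act P l T) (Mmod P l T)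
          (region P l T) (frobAdm P l T) (frobLogvol P l T) (frobΨ P l T) (frobMmod P l T) (unitImage P l T) (ballImage P l T)
          (thetaDiv P l T))
        (settingMSharp T.D (logvAnalyticVal_analyticLogvVal (K := T.K)) (M P l T) (archPk P l T) (archSub P l T) (Ψ P l T) (act P l T)
          (Mmod P l T) (region P l T) (n P l T) (lat P l T) (sig P l T) (split P l T) (qData P l T)
          (fun u i x => tThetaM T.D (ratChar u) u (natCast_ratChar_mem u) (ideleDataOf T.D T.isVolumeInputOf) i x)
          (fun u x => tqM T.D (ratChar u) u (natCast_ratChar_mem u) (ideleDataOf T.D T.isVolumeInputOf) x)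
          (fun u x => tqM_ne_zero T.D (ratChar u) u (natCast_ratChar_mem u) (ideleDataOf T.D T.isVolumeInputOf) x)
          (GenuineM.finite_ratPlaces_under_S T.D).toFinset
          (fun u x hu => norm_tqM_eq_one_of_not_mem T.D (ratChar u) u (natCast_ratChar_mem u) (ideleDataOf T.D T.isVolumeInputOf) x
            fun hx => hu ((Set.Finite.mem_toFinset _).mpr ⟨x, hx⟩)))
        (fun _ => Cor312.Setting.qRegion
        (settingMSharp T.D (logvAnalyticVal_analyticLogvVal (K := T.K)) (M P l T) (archPk P l T) (archSub P l T) (Ψ P l T) (act P l T)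
          (Mmod P l T) (region P l T) (n P l T) (lat P l T) (sig P l T) (split P l T) (qData P l T)
          (fun u i x => tThetaM T.D (ratChar u) u (natCast_ratChar_mem u) (ideleDataOf T.D T.isVolumeInputOf) i x)
          (fun u x => tqM T.D (ratChar u) u (natCast_ratChar_mem u) (ideleDataOf T.D T.isVolumeInputOf) x)
          (fun u x => tqM_ne_zero T.D (ratChar u) u (natCast_ratChar_mem u) (ideleDataOf T.D T.isVolumeInputOf) x)
          (GenuineM.finite_ratPlaces_under_S T.D).toFinset
          (fun u x hu => norm_tqM_eq_one_of_not_mem T.D (ratChar u) u (natCast_ratChar_mem u) (ideleDataOf T.D T.isVolumeInputOf) x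
            fun hx => hu ((Set.Finite.mem_toFinset _).mpr ⟨x, hx⟩)))) (qK P l T))
    -- [PIN] none: `Cor312Vol.QPinned … (fun _ => qRegion) (qK P l T)` is the theorem `qPinned_settingMSharp` (`rfl`) · [SIDE] none · [FACT] none
    -- [PROV] abc-iut-c312-8's provenance link (q-number; G1-Θ unit P5's `negLogQ_…M` AS TYPED via `isSettingOf_ofInitial`)
    (hprov : ∀ (P : NFPoint) (l : ℕ) (T : Cor22.ThetaVolumeDatumAt P l), letI := T.instFieldF; letI := T.instNumberFieldF; letI := T.instAlgebraF; letI := T.instFieldK;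
        letI := T.instNumberFieldK; letI := T.instAlgebraK; letI := T.instFieldFbar; letI := T.instAlgebraFbar;
        letI := T.instAlgebraKFbar; letI := T.instIsElliptic;
      Cor312Prov.IsSettingOf T.D
        (settingMSharp T.D (logvAnalyticVal_analyticLogvVal (K := T.K)) (M P l T) (archPk P l T) (archSub P l T) (Ψ P l T) (act P l T)
          (Mmod P l T) (region P l T) (n P l T) (lat P l T) (sig P l T) (split P l T) (qData P l T)
          (fun u i x => tThetaM T.D (ratChar u) u (natCast_ratChar_mem u) (ideleDataOf T.D T.isVolumeInputOf) i x)
          (fun u x => tqM T.D (ratChar u) u (natCast_ratChar_mem u) (ideleDataOf T.D T.isVolumeInputOf) x)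
          (fun u x => tqM_ne_zero T.D (ratChar u) u (natCast_ratChar_mem u) (ideleDataOf T.D T.isVolumeInputOf) x)
          (GenuineM.finite_ratPlaces_under_S T.D).toFinset
          (fun u x hu => norm_tqM_eq_one_of_not_mem T.D (ratChar u) u (natCast_ratChar_mem u) (ideleDataOf T.D T.isVolumeInputOf) x
            fun hx => hu ((Set.Finite.mem_toFinset _).mpr ⟨x, hx⟩))))
    -- [CONE] c312-8 p428563's `hreg`, verbatim (as v7)
    (hreg : ∀ P : NFPoint, P ∈ UP → ∀ l : ℕ, l.Prime → 5 ≤ l →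
      Cor22.AdmitsCore P → Cor22.CondP2 P l → Cor22.CondP5 P l → Cor22.CondP6 P l →
      ∀ T : Cor22.ThetaVolumeDatumAt P l,
        (letI := T.instFieldF; letI := T.instNumberFieldF; letI := T.instAlgebraF; letI := T.instFieldK
         letI := T.instNumberFieldK; letI := T.instAlgebraK; letI := T.instFieldFbar; letI := T.instAlgebraFbar
         letI := T.instAlgebraKFbar; letI := T.instIsElliptic
         ¬ (∀ p ∈ T.I.supportPrimes, ∀ v w : placesOver (fieldOfModuli T.E) p,
            (Summit.ABC.IUTFork.DHData.ofInput T.I).logQloc p v = (Summit.ABC.IUTFork.DHData.ofInput T.I).logQloc p w)) →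
        T.HullEstimateOf
          (((l : ℝ) + 1) / 4 *
            ((1 + 12 * (Cor22.dmod P : ℝ) / l) * (P.logDiff + Cor22.logCondAvoid P {2, l})
              + 2 * Real.log l + 52
              + 20 / 3 * Real.log (((2 ^ 12 * 3 ^ 3 * 5 * Cor22.dmod P : ℕ) : ℝ) * (l : ℝ))
                * (Nat.primeCounting (2 ^ 12 * 3 ^ 3 * 5 * Cor22.dmod P * l) : ℝ))))
    -- [READ] the ONE-SIDED Θ-side identification over the SAME carriers `K_{v̲}` (G1-Θ unit P6's deliverable AS TYPED)
    (hΘ : ∀ (P : NFPoint) (l : ℕ) (T : Cor22.ThetaVolumeDatumAt P l), letI := T.instFieldF; letI := T.instNumberFieldF; letI := T.instAlgebraF; letI := T.instFieldK;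
        letI := T.instNumberFieldK; letI := T.instAlgebraK; letI := T.instFieldFbar; letI := T.instAlgebraFbar;
        letI := T.instAlgebraKFbar; letI := T.instIsElliptic;
      (settingMSharp T.D (logvAnalyticVal_analyticLogvVal (K := T.K)) (M P l T) (archPk P l T) (archSub P l T) (Ψ P l T) (act P l T)
          (Mmod P l T) (region P l T) (n P l T) (lat P l T) (sig P l T) (split P l T) (qData P l T)
          (fun u i x => tThetaM T.D (ratChar u) u (natCast_ratChar_mem u) (ideleDataOf T.D T.isVolumeInputOf) i x)
          (fun u x => tqM T.D (ratChar u) u (natCast_ratChar_mem u) (ideleDataOf T.D T.isVolumeInputOf) x)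
          (fun u x => tqM_ne_zero T.D (ratChar u) u (natCast_ratChar_mem u) (ideleDataOf T.D T.isVolumeInputOf) x)
          (GenuineM.finite_ratPlaces_under_S T.D).toFinset
          (fun u x hu => norm_tqM_eq_one_of_not_mem T.D (ratChar u) u (natCast_ratChar_mem u) (ideleDataOf T.D T.isVolumeInputOf) x
            fun hx => hu ((Set.Finite.mem_toFinset _).mpr ⟨x, hx⟩))).negLogTheta ≤
        ((T.negLogTheta : ℝ) : WithTop ℝ))
    : _root_.ABC := by
  -- Step 1–2 (as v7): [IUTchIII] Cor 3.12 at EVERY genuine Θ-volume datum on the hull-level line at the M-setting, [PIN] := `rfl` (§2)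
  have h312 : ∀ (P : NFPoint) (l : ℕ), Cor22.Cor312AtDatum P l := fun P l T => by
    letI := T.instFieldF; letI := T.instNumberFieldF; letI := T.instAlgebraF; letI := T.instFieldK
    letI := T.instNumberFieldK; letI := T.instAlgebraK; letI := T.instFieldFbar; letI := T.instAlgebraFbar
    letI := T.instAlgebraKFbar; letI := T.instIsElliptic
    exact GenuineM.cor312Of_of_hull T.D (M P l T) (archPk P l T) (archSub P l T) (Ψ P l T) (act P l T) (Mmod P l T)
      (region P l T) (frobAdm P l T) (frobLogvol P l T) (frobΨ P l T) (frobMmod P l T) (unitImage P l T) (ballImage P l T)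
      (thetaDiv P l T) (n P l T) (lat P l T) (sig P l T) (split P l T) (qData P l T) (qK P l T) T.isVolumeInputOf
      (hBridge P l T) (hSH P l T) (hprov P l T) (hΘ P l T)
  exact ThetaPartII.ABC_of_cor312_of_hullRegime (fun P _ l _ _ _ _ _ _ => h312 P l) hreg

end Family
end Summit.ABC.IUTFork.Conditional
end
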